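import Summits.CriticalPhenomena.Ising3D.Control2DPolyCertAuto
import Mathlib.Tactic.Linarith
import Mathlib.Tactic.Positivity
import Mathlib.Tactic.FieldSimp
import Mathlib.Tactic.Ring
import HarnessLib

/-!
# Tensor-Bernstein positivity decided IN the kernel (bivariate degree elevation; no coefficient literals)
(cell `pub-ising3x`, seat controls-1 gen 17; KERNEL PATH for the 2D γ-certificates — CONTROL-ONLY scaffolding)

HONEST FRAMING: lottery ticket; floor = tightest certified 3D Ising CFT bounds; no exact-solution
claim without a proof. Nothing numerical about any CFT is asserted here.

`bernCheck₂` (`Control2DPolyCert2`, g16) compares the transformed bivariate polynomial with the tensor-Bernstein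
form `zbernO cs` of a SUPPLIED coefficient table `cs`. At Λ = 13 the region certificate of a table needs ≈ 170
such leaves of 14 × 14 integers with ≤ 141 digits (3.8 MB of literals; measured 2026-08-22) — not a tree file.
This file decides tensor-Bernstein positivity with NO supplied coefficients, by degree elevation in both variables
(the bivariate twin of `Control2DPolyCertAuto`):
* inner variable: every row `r` (padded to length `n`) is replaced by `bernCoeffs (zpad n r)`; for `u ≠ 1`,
  `A(t, u) = (1-u)^{n-1} · A'(t, u/(1-u))` (`evalR₂_rowBern`);
* outer variable: `bernCoeffs₂` = the elevation fold on the LIST OF ROWS (`bernStep₂`), with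
  `(1-t)^{|A'|-1} · D(t/(1-t), w) = A'(t, w)` (`bernV₂_bernCoeffs₂`);
* `bernPos₂ A n` := all rows of `A` have length `≤ n` and all entries of `D` are `≥ 0` ⇒ `A ≥ 0` on `[0,1]²`
  (`[0,1)²` by the two identities and the corner test, the edges by continuity), and
  `bernAuto₂ P n q₁ a₁ L₁ q₂ a₂ L₂ := bernPos₂ (zaffO q₁ a₁ L₁ (zaffI n q₂ a₂ L₂ P)) n` ⇒ `P ≥ 0` on the box
  (`evalR₂_nonneg_of_bernAuto₂`, same frame as `evalR₂_nonneg_of_bernCheck₂`).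
Exact mirror: HOME/code/controls/kp4/kmirror2.py (`bernCoeffs2`, `bernPos2`, `bernAuto2`). Elementary; no facts. [folklore]
-/

namespace Summit.CriticalPhenomena.Ising3D.Control2D

open Filter Topology
open Literature.Analysis.ValidatedNumerics.PolyMP

/-! ### Continuity and the closed-edge argument -/

/-- [folklore] -/
theorem evalR₂_continuous_left (y : ℝ) : ∀ P : List (List ℤ), Continuous fun x : ℝ => evalR₂ P x y
  | [] => by simpa using continuous_const
  | r :: rs => by
      simp only [evalR₂_cons]
      exact continuous_const.add (continuous_id.mul (evalR₂_continuous_left y rs))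

/-- [folklore] -/
theorem evalR₂_continuous_right (x : ℝ) : ∀ P : List (List ℤ), Continuous fun y : ℝ => evalR₂ P x y
  | [] => by simpa using continuous_const
  | r :: rs => by
      simp only [evalR₂_cons]
      exact (evalR_continuous (castZ r)).add (continuous_const.mul (evalR₂_continuous_right x rs))

/-- A continuous function that is `≥ 0` on `[0, 1)` is `≥ 0` at `1`. [folklore] -/
theorem nonneg_one_of_nonneg_Ico {f : ℝ → ℝ} (hf : Continuous f) (h : ∀ x : ℝ, 0 ≤ x → x < 1 → 0 ≤ f x) :
    0 ≤ f 1 := by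
  have hcont : Tendsto f (𝓝[Set.Ioo 0 1] 1) (𝓝 (f 1)) := (hf.tendsto 1).mono_left nhdsWithin_le_nhds
  have hev : ∀ᶠ x in 𝓝[Set.Ioo 0 1] (1 : ℝ), 0 ≤ f x :=
    eventually_nhdsWithin_of_forall fun x hx => h x hx.1.le hx.2
  haveI : (𝓝[Set.Ioo 0 1] (1 : ℝ)).NeBot := right_nhdsWithin_Ioo_neBot zero_lt_one
  exact ge_of_tendsto hcont hev

/-- A continuous function that is `≥ 0` on `[0, 1)` is `≥ 0` on `[0, 1]`. [folklore] -/
theorem nonneg_Icc_of_nonneg_Ico {f : ℝ → ℝ} (hf : Continuous f) (h : ∀ x : ℝ, 0 ≤ x → x < 1 → 0 ≤ f x)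
    {x : ℝ} (hx0 : 0 ≤ x) (hx1 : x ≤ 1) : 0 ≤ f x := by
  rcases lt_or_eq_of_le hx1 with hlt | rfl
  · exact h x hx0 hlt
  · exact nonneg_one_of_nonneg_Ico hf h

/-! ### Inner variable: every row in Bernstein coordinates -/

/-- Replace every row by the Bernstein coefficients of its padding to length `n`. [folklore] -/
def rowBern (n : ℕ) (A : List (List ℤ)) : List (List ℤ) := A.map fun r => bernCoeffs (zpad n r)

/-- **`A(t, u) = (1-u)^{n-1} · (rowBern n A)(t, u/(1-u))`** for `u ≠ 1`, all rows of length `≤ n`. [folklore] -/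
theorem evalR₂_rowBern (n : ℕ) {u : ℝ} (hu : u ≠ 1) (t : ℝ) :
    ∀ A : List (List ℤ), (∀ r ∈ A, r.length ≤ n) →
      evalR₂ A t u = (1 - u) ^ (n - 1) * evalR₂ (rowBern n A) t (u / (1 - u))
  | [], _ => by simp [rowBern]
  | r :: rs, h => by
      have hr : r.length ≤ n := h r (by simp)
      have ih := evalR₂_rowBern n hu t rs fun r' hr' => h r' (by simp [hr'])
      have hrow : evalR (castZ r) u = (1 - u) ^ (n - 1) * evalR (castZ (bernCoeffs (zpad n r))) (u / (1 - u)) := by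
        rw [← evalR_zpad n r u, ← bernV_bernCoeffs (zpad n r) hu, bernV, length_bernCoeffs, length_zpad hr]
      simp only [rowBern, List.map_cons, evalR₂_cons]
      rw [← rowBern, hrow, ih]
      ring

/-! ### Outer variable: degree elevation on the list of rows -/

/-- One elevation step on rows: `(R_0, …, R_m) ↦ (R_0, R_0 + R_1, …, R_{m-1} + R_m, R_m + a)`. [folklore] -/
def bernStep₂ (R : List (List ℤ)) (a : List ℤ) : List (List ℤ) := zadd₂ (R ++ [a]) ([] :: R)

/-- Bivariate unnormalised Bernstein coefficients in the OUTER variable (rows untouched as units). [folklore] -/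
def bernCoeffs₂ : List (List ℤ) → List (List ℤ)
  | [] => []
  | r :: rs => rs.foldl bernStep₂ [r]

/-- [folklore] -/
theorem length_zadd₂_of_le : ∀ (U V : List (List ℤ)), V.length ≤ U.length → (zadd₂ U V).length = U.length
  | [], [], _ => rfl
  | [], _ :: _, h => by simp at h
  | _ :: _, [], _ => rfl
  | r :: rs, s :: ss, h => by
      simp only [zadd₂, List.length_cons, length_zadd₂_of_le rs ss (by simpa using h)]

/-- [folklore] -/
theorem length_bernStep₂ (R : List (List ℤ)) (a : List ℤ) : (bernStep₂ R a).length = R.length + 1 := by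
  unfold bernStep₂
  rw [length_zadd₂_of_le _ _ (by simp)]
  simp

/-- [folklore] -/
theorem evalR₂_append_singleton (x y : ℝ) : ∀ (R : List (List ℤ)) (a : List ℤ),
    evalR₂ (R ++ [a]) x y = evalR₂ R x y + x ^ R.length * evalR (castZ a) y
  | [], a => by simp
  | r :: rs, a => by
      rw [List.cons_append, evalR₂_cons, evalR₂_append_singleton x y rs a, evalR₂_cons, List.length_cons,
        pow_succ]
      ring

/-- `(1-t)^{|R|-1} · R(t/(1-t), w)`. [folklore] -/
noncomputable def bernV₂ (R : List (List ℤ)) (t w : ℝ) : ℝ :=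
  (1 - t) ^ (R.length - 1) * evalR₂ R (t / (1 - t)) w

/-- **One elevation step adds `t^{|R|} · a(w)`** (`R ≠ []`, `t ≠ 1`). [folklore] -/
theorem bernV₂_bernStep₂ (R : List (List ℤ)) (hR : R ≠ []) (a : List ℤ) {t : ℝ} (ht : t ≠ 1) (w : ℝ) :
    bernV₂ (bernStep₂ R a) t w = bernV₂ R t w + t ^ R.length * evalR (castZ a) w := by
  obtain ⟨k, hk⟩ : ∃ k, R.length = k + 1 := ⟨R.length - 1, by
    have := List.length_pos_of_ne_nil hR; omega⟩
  have hs : (1 : ℝ) - t ≠ 0 := sub_ne_zero.mpr (Ne.symm ht)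
  unfold bernV₂
  rw [length_bernStep₂, hk, bernStep₂, evalR₂_zadd₂, evalR₂_append_singleton, evalR₂_cons, hk]
  simp only [Nat.add_sub_cancel, castZ_nil, evalR_nil, zero_add]
  rw [div_pow, pow_succ]
  field_simp
  ring

/-- **The fold adds the remaining outer power tail.** [folklore] -/
theorem bernV₂_foldl (t w : ℝ) (ht : t ≠ 1) : ∀ (as : List (List ℤ)) (R : List (List ℤ)), R ≠ [] →
    bernV₂ (as.foldl bernStep₂ R) t w = bernV₂ R t w + t ^ R.length * evalR₂ as t w
  | [], R, _ => by simp
  | a :: as, R, hR => by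
      have hne : bernStep₂ R a ≠ [] := by
        intro h; have := congrArg List.length h; rw [length_bernStep₂] at this; simp at this
      rw [List.foldl_cons, bernV₂_foldl t w ht as (bernStep₂ R a) hne, bernV₂_bernStep₂ R hR a ht w,
        length_bernStep₂, evalR₂_cons, pow_succ]
      ring

/-- **`(1-t)^{|A|-1} · (bernCoeffs₂ A)(t/(1-t), w) = A(t, w)`** for `t ≠ 1`. [folklore] -/
theorem bernV₂_bernCoeffs₂ (A : List (List ℤ)) {t : ℝ} (ht : t ≠ 1) (w : ℝ) :
    bernV₂ (bernCoeffs₂ A) t w = evalR₂ A t w := by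
  cases A with
  | nil => simp [bernCoeffs₂, bernV₂]
  | cons r rs =>
      rw [bernCoeffs₂, bernV₂_foldl t w ht rs [r] (by simp), evalR₂_cons]
      simp [bernV₂]

/-- **Corner test (bivariate)**: all entries `≥ 0` ⇒ `D(x, y) ≥ 0` for `x, y ≥ 0`. [folklore] -/
theorem evalR₂_nonneg_of_all_nonneg : ∀ (D : List (List ℤ)), (∀ r ∈ D, ∀ c ∈ r, (0 : ℤ) ≤ c) →
    ∀ {x y : ℝ}, 0 ≤ x → 0 ≤ y → 0 ≤ evalR₂ D x y
  | [], _, x, y, _, _ => by simp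
  | r :: rs, h, x, y, hx, hy => by
      rw [evalR₂_cons]
      have h1 := evalR_nonneg_of_all_nonneg r (h r (by simp)) hy
      have ih := evalR₂_nonneg_of_all_nonneg rs (fun r' hr' => h r' (by simp [hr'])) hx hy
      positivity

/-! ### The decision and its soundness -/

/-- **Tensor-Bernstein positivity on `[0,1]²` decided in the kernel**: rows of length `≤ n` and all
bivariate elevated coefficients `≥ 0`. [folklore] -/
def bernPos₂ (A : List (List ℤ)) (n : ℕ) : Bool :=
  A.all (fun r => decide (r.length ≤ n)) &&
    (bernCoeffs₂ (rowBern n A)).all fun r => r.all fun c => decide (0 ≤ c)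

/-- **Soundness of `bernPos₂`**: `A(t, u) ≥ 0` on `[0,1]²`. PROVED (`[0,1)²` by `evalR₂_rowBern`,
`bernV₂_bernCoeffs₂` and the corner test; the edges `t = 1`, `u = 1` by continuity). [folklore] -/
theorem evalR₂_nonneg_of_bernPos₂ {A : List (List ℤ)} {n : ℕ} (h : bernPos₂ A n = true) {t u : ℝ}
    (ht0 : 0 ≤ t) (ht1 : t ≤ 1) (hu0 : 0 ≤ u) (hu1 : u ≤ 1) : 0 ≤ evalR₂ A t u := by
  simp only [bernPos₂, Bool.and_eq_true, List.all_eq_true, decide_eq_true_eq] at h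
  obtain ⟨hlen, hall⟩ := h
  -- the open square
  have hopen : ∀ t' u' : ℝ, 0 ≤ t' → t' < 1 → 0 ≤ u' → u' < 1 → 0 ≤ evalR₂ A t' u' := by
    intro t' u' ht0' ht1' hu0' hu1'
    rw [evalR₂_rowBern n hu1'.ne t' A hlen]
    have h1u : (0 : ℝ) ≤ 1 - u' := by linarith
    have hw : 0 ≤ u' / (1 - u') := div_nonneg hu0' h1u
    refine mul_nonneg (pow_nonneg h1u _) ?_
    rw [← bernV₂_bernCoeffs₂ (rowBern n A) ht1'.ne, bernV₂]
    have h1t : (0 : ℝ) ≤ 1 - t' := by linarith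
    have hs : 0 ≤ t' / (1 - t') := div_nonneg ht0' h1t
    exact mul_nonneg (pow_nonneg h1t _) (evalR₂_nonneg_of_all_nonneg _ hall hs hw)
  -- close the edge `t = 1` for `u < 1`, then the edge `u = 1` for all `t`
  have hu_lt : ∀ u' : ℝ, 0 ≤ u' → u' < 1 → 0 ≤ evalR₂ A t u' := fun u' hu0' hu1' =>
    nonneg_Icc_of_nonneg_Ico (evalR₂_continuous_left u' A) (fun t' h0 h1 => hopen t' u' h0 h1 hu0' hu1')
      ht0 ht1
  exact nonneg_Icc_of_nonneg_Ico (evalR₂_continuous_right t A) hu_lt hu0 hu1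

/-- **Tensor-Bernstein positivity of `P` on a rational box decided in the kernel** (outer variable
`[a₁/q₁, (a₁+L₁)/q₁]`, inner `[a₂/q₂, (a₂+L₂)/q₂]`, rows padded to `n`). [folklore] -/
def bernAuto₂ (P : List (List ℤ)) (n : ℕ) (q₁ a₁ L₁ q₂ a₂ L₂ : ℤ) : Bool :=
  P.all (fun r => decide (r.length ≤ n)) && bernPos₂ (zaffO q₁ a₁ L₁ (zaffI n q₂ a₂ L₂ P)) n

/-- **Soundness of `bernAuto₂`**: `P(x, y) ≥ 0` on the box (`q₁, q₂ > 0`, `L₁, L₂ ≥ 0`). PROVED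
(`x = (a₁ + L₁ t)/q₁`, `y = (a₂ + L₂ u)/q₂`, `q₁^{|P|-1} q₂^{n-1} P(x, y) = A(t, u) ≥ 0`). [folklore] -/
theorem evalR₂_nonneg_of_bernAuto₂ {P : List (List ℤ)} {n : ℕ} {q₁ a₁ L₁ q₂ a₂ L₂ : ℤ}
    (hq₁ : 0 < q₁) (hq₂ : 0 < q₂) (hL₁ : 0 ≤ L₁) (hL₂ : 0 ≤ L₂)
    (h : bernAuto₂ P n q₁ a₁ L₁ q₂ a₂ L₂ = true) {x y : ℝ}
    (hx1 : (a₁ : ℝ) / q₁ ≤ x) (hx2 : x ≤ ((a₁ : ℝ) + L₁) / q₁)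
    (hy1 : (a₂ : ℝ) / q₂ ≤ y) (hy2 : y ≤ ((a₂ : ℝ) + L₂) / q₂) : 0 ≤ evalR₂ P x y := by
  simp only [bernAuto₂, Bool.and_eq_true, List.all_eq_true, decide_eq_true_eq] at h
  obtain ⟨hlen, hpos⟩ := h
  have hq₁R : (0 : ℝ) < q₁ := by exact_mod_cast hq₁
  have hq₂R : (0 : ℝ) < q₂ := by exact_mod_cast hq₂
  obtain ⟨t, ht0, ht1, ht⟩ := exists_unitParam hq₁ hL₁ hx1 hx2
  obtain ⟨u, hu0, hu1, hu⟩ := exists_unitParam hq₂ hL₂ hy1 hy2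
  have key := evalR₂_zaffO hq₁R.ne' a₁ L₁ t u (zaffI n q₂ a₂ L₂ P)
  rw [length_zaffI, ht, evalR₂_zaffI hq₂R.ne' n a₂ L₂ x u P hlen, hu] at key
  have hB := evalR₂_nonneg_of_bernPos₂ hpos ht0 ht1 hu0 hu1
  rw [key, ← mul_assoc] at hB
  have hc : (0 : ℝ) < (q₁ : ℝ) ^ (P.length - 1) * (q₂ : ℝ) ^ (n - 1) := by positivity
  exact (mul_nonneg_iff_of_pos_left hc).mp hB

end Summit.CriticalPhenomena.Ising3D.Control2D
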